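import Mathlib
import HarnessLib
import HarnessLib.Audit
import Summits.FinalStateConjecture.Statement
import Literature.Geometry.Lorentzian.KillingSpinorData

/-!
Route: KerrnessPropagates

DORMANT since 2026-09-04T18:32:23Z (reconciler: no traction for 5 d (last activity statement-checked at 2026-08-30T17:39:34Z); parked, not closed — `ledger route dormant route-FinalStateConjecture-KerrnessPropagates --off` to reactivate) — unstaffed, not closed; items shared with open routes are served there. `ledger route dormant <id> --off` reactivates.

# Route KerrnessPropagates — capture hands over exact Kerr charges; a modulation-free Killing-spinor
endgame decides the rest

It suffices to show X = CAPTURE ∧ ENDGAME. CAPTURE (the one generic statement; genericity is not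
closed under ∧, so all generic content sits here): for TAME-Christodoulou-generic admissible data
(one-parameter admissible families tame on ONE fixed end and immersed at the base datum; re-type T2,
p126844) every MGHD has complete 𝓘⁺, RECURS to one fixed multi-Kerr configuration p = (N; Mᵢ, aᵢ
sub-extremal; inner radii r₀ᵢ ∈ (r₋, r₊); Poincaré motions (Λᵢ, cᵢ)): for every accuracy ε > 0 and
arbitrarily late lab times τ there is ONE smooth open embedding Φ of a neighbourhood of the
hyperplane {x⁰ = τ} minus the inner discs {rᵢ ≤ r₀ᵢ} whose pulled-back metric is ε-close in Cᵏ (sup)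
to boosted Kerr–Schild Kerrᵢ on the horizon-penetrating near discs {r₀ᵢ < rᵢ ≤ Rᵢ} and to η on {all
rⱼ ≥ Rⱼ − 1}, with achronal slab image in J⁺(ι X), FUTURE-ORIENTED (on that far zone the
push-forward Φ_*∂₀ is future-directed causal — increasing lab time is the g-future; the slab
analogue of the Statement's `IsFutureOriented`), and HIDES NO COMPLETE RAY: for every honest C² Kerr
decomposition (O, d) of that MGHD (sub-extremal holes, O = J⁺(ιX) ∩ I⁻(charted), exhaustive
future-oriented charts) every future-complete normalised null ray from Σ stays in closure O (the
INTERIOR LEMMA — the content of the Statement's `RaysStayInClosure`, which is generic-only: an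
honestly settling exterior says nothing about future-complete rays in a baby universe behind a
throat, so it sits in the one generic statement, not in the pointwise endgame). ENDGAME (pointwise
in the datum, no genericity, realises card killing-spinor-obstruction-as-linear-field):
future-oriented recurrence to p (for one k of the prover's choosing) plus the interior lemma force
the typed conclusion — an exhaustive (honest growing near-zone radii), future-oriented C² N-Kerr
FinalStateDecomposition with sub-extremal holes of the self-determined exterior O, every
future-complete null ray from Σ staying in closure O (discharged by the interior lemma applied to
the decomposition just built). Because CAPTURE hands over the EXACT final charges (Mᵢ, aᵢ, Λᵢ) as
recurrence data, ENDGAME is a pure decay problem with known charges: the modulation-free, gauge-free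
form in which the card's engine works — propagate the Killing-spinor obstruction ζ = (H, S) of the
dynamical metric as a homogeneous linear field on its own spacetime and prove ζ → 0.
Lean: `KerrBasinCapture ∧ KillingSpinorEndgame` — both decls below elaborate (Sketch.lean rc 0,
2026-08-16) over `Literature.Geometry.Lorentzian.{admissibleVacuumData, VacuumCauchyDevelopment,
InitialDataSet.IsTameChristodoulouGeneric, Kerr.IsSubextremal, Kerr.rMinus, Kerr.rPlus, Kerr.radius,
lorentzGroup, poincareInv, boostedKerrBilin, Minkowski.backgroundOn, supCkENorm,
Spacetime.deviationExtend, FinalStateDecomposition, LorentzianMetric.causalFuture,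
LorentzianMetric.IsAchronal, TimeOrientation.IsFutureDirected, E4.basisVector}`, Mathlib's
`mfderiv`, and `Summit.FinalStateConjecture.{HasCompleteNullInfinity, exteriorOf, RaysStayInClosure,
HasExhaustiveCharts, IsFutureOriented}`.

## Assembly
Pure logic, proved sorry-free in Sketch.lean / glue.lean (theorem `closes`): fix k from
KillingSpinorEndgame; for each X, KerrBasinCapture k X is tame Christodoulou-genericity of Q_k =
"every MGHD has complete 𝓘⁺, recurs future-orientedly, and hides no complete ray";
MaximalDevelopmentExists and KillingSpinorEndgame give Q_k D → P D for every admissible D, where P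
is verbatim the re-typed Statement's property (complete 𝓘⁺ ∧ ∃ O d, sub-extremal ∧ O = exteriorOf ∧
RaysStayInClosure ∧ HasExhaustiveCharts ∧ IsFutureOriented); and
`InitialDataSet.IsTameChristodoulouGeneric 𝓓 · 1` is monotone in the property (a datum failing P
fails Q_k, and the tame immersed admissible curve on one fixed end through it whose other members
satisfy Q_k has other members satisfying P — the witness pair (e, F) is reused verbatim).

Rationale: WHY THIS LINE. A vacuum spacetime is locally Kerr iff it carries a valence-2 Killing spinor; for ANY
vacuum metric one can propagate a Killing-spinor candidate by □κ_AB + Ψ_ABCD κ^CD = 0, and then the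
obstruction ζ = (H = ∇_{A'(A}κ_{BC)}, S = ∇_{(a}ξ_{b)}) obeys a CLOSED HOMOGENEOUS linear wave
system on the dynamical spacetime (García-Parrado–Valiente Kroon arXiv:0712.3373), while the
Bäckdahl–Valiente Kroon non-Kerrness invariant I[Σ] of a slice (arXiv:1005.0743, arXiv:1010.2421,
arXiv:1001.4492) is its initial size; Andersson–Blue (AnderssonBlue2015) proved Morawetz on Kerr
with hidden-symmetry commutators alone, and Andersson–Bäckdahl–Blue–Ma (arXiv:1903.03859,
arXiv:2108.03148) built linear stability on the same spinorial structures. The route imports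
spinor/hidden-symmetry geometry (exact-solutions characterisation theory) into the stability
endgame: instead of modulating (M, a) through GCM spheres (KlainermanSzeftel2023,
GiorgiKlainermanSzeftel2022), the charges are fixed by CAPTURE's recurrence datum and the unknown is
the gauge-invariant field ζ. The backbone is deliberately the weakest endgame that still decides the
Statement: "recurrent ε-approach to a fixed sub-extremal configuration ⇒ convergence" is implied by,
and strictly weaker than, sub-extremal Kerr stability (DafermosRodnianski2008 Conj. 5.1) for N = 1,
and closes the Statement by monotonicity of TAME Christodoulou genericity (proved, glue.lean).
Re-type T2 (2026-08-16) is absorbed as follows: tame genericity on one fixed end replaces the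
topology-free notion in CAPTURE; the hand-over slab is future-oriented (Φ_*∂₀ future-directed on the
far zone, the slab analogue of `IsFutureOriented`); and the interior clause `RaysStayInClosure` is
handed over as the INTERIOR LEMMA 'an honestly charted exterior hides no future-complete null ray
from Σ' inside CAPTURE's one generic statement — it is generic-only content (bag-of-gold data: an AF
end glued through a throat to an eternally expanding compact vacuum region, cf. the gluing of
arXiv:gr-qc/0403066 and the future-complete Einstein flows of arXiv:0908.0784, would settle honestly
outside while hiding complete rays inside), so the pointwise ENDGAME takes it as a hypothesis and
stays a pure exterior decay problem. No prior route existed on this summit at open; the negatives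
index was empty.

RANKED CRUXES. #2 KillingSpinorEndgame (crux) — ENDGAME (card
killing-spinor-obstruction-as-linear-field, items D3–D5 fused into one typed statement): there is a
regularity k such that for every admissible datum, every MGHD with complete 𝓘⁺ which recurs (every
ε, arbitrarily late τ, one lab-time chart, horizon-penetrating near discs, flat far zone, achronal
slab in J⁺(ιX), Φ_*∂₀ future-directed on the far zone) to a FIXED sub-extremal multi-Kerr
configuration p, and in which every honest C² Kerr decomposition keeps the future-complete null rays
from Σ in the closure of its exterior (interior lemma, hypothesis), admits an exhaustive (honest
growing radii), future-oriented C² FinalStateDecomposition of its exterior O = J⁺(ιX) ∩ I⁻(charted)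
with sub-extremal holes and RaysStayInClosure O (the last by the hypothesis applied to the
decomposition built). Intended proof: non-Kerrness of the recurrent slabs is O(ε) (continuity at
Kerr data), ζ solves the closed homogeneous GP-VK system on the bootstrap region, hidden-symmetry
commutators built from κ itself give integrated decay of ζ (red-shift needs |aᵢ| < Mᵢ), coercivity
turns ζ → 0 plus the KNOWN charges p into Cᵏ convergence of horizon-normalised Kerr–Schild charts on
near zones growing like R(τ) → ∞ (honest radii), future-oriented because the seed slab is; N ≥ 2
adds only integrably decaying tidal sources because recurrence to fixed distinct motions forces
linear separation. [difficulty: open-problem] (why it might fail: contains sub-extremal Kerr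
asymptotic stability for all |a|<M (open beyond |a|≪M) and an N≥2 weak-interaction theorem nobody
has; far-zone smallness handed over is unweighted sup-norm, so decay at i⁰ must be recovered from
o₂(r⁻¹) admissibility — possibly too rough for C² convergence on near zones that must now GROW, R(τ)
→ ∞.) [DafermosRodnianski2008, KlainermanSzeftel2023, GiorgiKlainermanSzeftel2022,
DafermosHolzegelRodnianskiTaylor2021, AnderssonBlue2015, arXiv:0712.3373, arXiv:1010.2421,
arXiv:1903.03859]
#3 KerrBasinCapture (crux) — CAPTURE (the large-data leg, shared in spirit with every architecture
card; here in the recurrence-to-fixed-charges form the endgame consumes): for every k and every data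
manifold X, TAME-Christodoulou-generically in admissibleVacuumData X (`IsTameChristodoulouGeneric …
1`: the escaping curve is tame on one fixed end and immersed at the exceptional datum), every
maximal vacuum Cauchy development has complete future null infinity (weak cosmic censorship),
recurs, for every ε > 0 and beyond every lab time, to one fixed configuration p = (N, Mᵢ, aᵢ, r₀ᵢ,
Λᵢ, cᵢ) in the future-oriented one-chart slab sense of § Thesis, and satisfies the interior lemma
(every honest C² Kerr decomposition (O, d) — sub-extremal, O = exteriorOf, HasExhaustiveCharts,
IsFutureOriented — has RaysStayInClosure O). It is implied by the re-typed Statement's conclusion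
upgraded from C² to Cᵏ and weakened from convergence to recurrence, except that the interior lemma
is asked of EVERY honest decomposition rather than of one; it carries censorship, no eternal
non-Kerr/soliton end states, finiteness of N, eventual sub-extremality, the absence of eternally
bound clusters, and 'no future-complete null ray from Σ hides behind an honestly charted exterior'.
[difficulty: open-problem] (why it might fail: it is weak cosmic censorship plus 'generic end states
are receding multi-Kerr clusters' — wide open; fails if tame codimension-1 curve-genericity cannot
absorb threshold phenomena (Cantor families of critical collapse), if Cᵏ-recurrence is false for
data only o₂(r⁻¹)-flat at infinity, or — through the interior lemma alone — if some X carries an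
open set of admissible data whose MGHDs keep a future-complete null ray from Σ inside a baby
universe (bag of gold) while settling honestly outside; the last would be a finding against clause
(C) of the re-typed Statement itself.) [Christodoulou1999, DafermosLuk2017, Penrose1982,
Christodoulou2008, ChristodoulouKlainerman1993, arXiv:gr-qc/0403066, arXiv:0908.0784]
#9 MaximalDevelopmentExists (crux, rank 9; since rev 10 the summit's SHARED item
stmt-FinalStateConjecture-9937, badged crux so that `closes` is crux-only) — every admissible datum
has a maximal vacuum Cauchy development (Choquet-Bruhat–Geroch 1969, Thm. 3; Sbierski 2016, Thm.
2.6) over the repaired structure `VacuumCauchyDevelopment … IsMaximal` — the anti-vacuity conjunct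
of the Statement, a known theorem not yet vendored over the repaired structure (unproved tree fact
`choquetBruhat_geroch_exists_mghd_cauchy`; CauchyProblemCauchy.lean records why); residual risk =
the typing of `IsMaximal`. [difficulty: XL] (why it might fail: known in print but typing-exposed —
IsMaximal makes every typed VacuumCauchyDevelopment of D embed ι-compatibly into one; the first
render over VacuumDevelopment was refuted: isEmpty.) [ChoquetBruhatGeroch1969CMP, Ringstrom2009,
Sbierski2016AHP]
#9 SingleKerrEndgame (support) — the N = 1 special case of KillingSpinorEndgame with scalar
parameters (M, a, r₀, Λ, c): future-oriented recurrence to one fixed sub-extremal Kerr plus the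
interior lemma ⇒ an exhaustive, future-oriented, ray-closed one-hole C² decomposition (d.N = 1).
This is where the card's engine applies verbatim (nonlinear Andersson–Blue with known charges);
strictly weaker than Dafermos–Rodnianski Conj. 5.1 in the recurrence hypothesis, stronger in the
exhaustive-charts conclusion. [difficulty: open-problem] [DafermosRodnianski2008,
KlainermanSzeftel2023, AnderssonBlue2015, arXiv:0712.3373, arXiv:1005.0743]

TWO-LAYER PLAN. Once the two definition requests land, KillingSpinorEndgame is split (glued, k = 3):
KillingSpinorCoercivity (quantitative Bäckdahl–Valiente Kroon: non-Kerrness + charge defect of an AF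
vacuum slab datum with inner MOTS boundary controls its Hˢ-distance to Kerr–Schild Kerr data) →
ObstructionFieldDecay (integrated + pointwise decay of the GP-VK obstruction system on exact
sub-extremal Kerr, all |a| < M, modulo an explicit finite-dimensional stationary family fixed by the
charges) → NearKerrBootstrap (on a recurrently ε-Kerr development the approximate hidden-symmetry
commutators built from κ close the Morawetz/rᵖ/red-shift estimates for ζ and for the curvature it
controls) → KillingSpinorEndgame for N = 1 (= SingleKerrEndgame); then SingleKerrEndgame +
RecedingDecoupling (tidal sources O((vt)⁻³) are integrable) → KillingSpinorEndgame. The first two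
children are filed now as INFORMAL ranked cruxes (no Lean carrier for spinors yet), the GP-VK
propagation identity as informal support. KerrBasinCapture is not decomposed by this route (it is
the arena of the architecture cards: lasalle-bondi-lyapunov-liouville,
tangent-cone-at-timelike-infinity, two-boundary-squeeze-observability-lojasiewicz,
burnett-limit-photons-kinetic-rigidity); a sibling route owning CAPTURE can share the decl.

KILL CRITERIA. Refutation of KillingSpinorEndgame by an explicit recurrent-but-non-convergent vacuum
development (or by showing the typed hypotheses admit a non-cross-section slab) closes the route
`refuted:KillingSpinorEndgame` unless the witness only exploits the unweighted far-zone norm (then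
pivot: restate with the datum's weighted decay propagated to the slab). Refutation of the informal
crux KillingSpinorCoercivity (an AF vacuum slab datum with vanishing non-Kerrness and Kerr charges
that is not Kerr data — e.g. built from another Petrov-D vacuum) kills the ENGINE: the route then
either closes `refuted:` or is superseded by a GCM-based endgame route sharing KerrBasinCapture.
KerrBasinCapture refuted (e.g. by the typing exploits of cards genericity-is-not-closed-under-and /
threshold-lamination-vs-curve-genericity, or through the interior lemma by a bag-of-gold MGHD)
breaks every capture+endgame architecture at once — close and hand the witness to the Statement
audit (a bag-of-gold witness is a finding against the Statement's clause (C), not against this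
line). Sub-extremal Kerr stability proved elsewhere by GCM methods for all |a| < M moots
SingleKerrEndgame's novelty but not the route.

NOT DECOMPOSED YET. The Nearkerr bootstrap constants, the choice of k (expected k ≈ 20 from
rᵖ/commutator losses), the precise elliptic gauge fixing κ on a slab (B–VK minimiser vs. harmonic
extension), the finite-dimensional 'Killing-spinor charge' family on Kerr (card D2), the N ≥ 2
decoupling lemma, and every piece of KerrBasinCapture (censorship, no-soliton Liouville theorems,
finiteness of N, sub-extremality of the limit, the interior lemma = incompleteness of every null ray
from Σ entering a generic black-hole interior, cf. DafermosLuk2017) — all layer-2, after a crux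
closes or a definition lands.

CHEAPEST FALSIFIER. Card D1/D5 checks, in this order: (i) read García-Parrado–Valiente Kroon
arXiv:0712.3373 §§4–5 and confirm the (H, S) system closes homogeneously in vacuum with □κ = −Ψκ and
NO further zero-quantity (if an inhomogeneous source not controlled by ζ appears, the engine is dead
— a one-afternoon literature check); (ii) the C-metric / Kerr–NUT test for KillingSpinorCoercivity:
every Petrov-D vacuum carries a Killing spinor, so exhibit (or rule out) an asymptotically flat
one-ended vacuum slab datum with I = 0 and Kerr charges that is not a Kerr slab — if it exists with
the inner-MOTS boundary condition, coercivity is false as stated. I could not run (i) this session: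
lit searchd/galaxy were unavailable (rc 75) at filing; the refuter audit of the card already READ
arXiv:1001.4492 p. 5 and GP-VK and confirmed (i) is GP-VK's propagation theorem (hence filed as
support, not crux).

NUMBERS. Known endgame thresholds: |a|/M ≪ 1 (KlainermanSzeftel2023 Thm. 1.2.1 with
GiorgiKlainermanSzeftel2022, Shen 2022); a = 0 in codimension 3
(DafermosHolzegelRodnianskiTaylor2021 Thm. I.3.1); linear Teukolsky decay for all |a| < M
(ShlapentokhrothmanCosta2020, ShlapentokhrothmanCosta2023); Morawetz by hidden-symmetry commutators
for |a| ≪ M (AnderssonBlue2015). Typed Statement regularity: data o₂(r⁻¹)/o₁(r⁻²), conclusion C²;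
this route's recurrence is Cᵏ with k existential in ENDGAME and universal in CAPTURE. Items at open:
5 typed (2 cruxes, 2 support, 1 assembly) + 3 informal filed after open; after the re-type repair
(2026-08-16, revs 8–10): 6 typed (4 cruxes incl. KillingSpinorCoercivity and the rank-9 shared MGHD
item, 1 support, 1 assembly) + 2 informal (1 crux, 1 support); restated 1:1: KillingSpinorEndgame,
KerrBasinCapture, SingleKerrEndgame, MaximalDevelopmentExists (→ stmt-9937 verbatim).

DEFINITION REQUESTS. (1) notion KillingSpinorDataDefect — for a smooth vacuum initial data set (S,
h, K) on an oriented 3-manifold (spin structure trivialised on slabs of E3): the space-spinor /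
complex-vector form of the Killing-spinor initial data equations of García-Parrado–Valiente Kroon
(arXiv:0712.3373 Thm.) and the Bäckdahl–Valiente Kroon non-Kerrness functional I[S, h, K] ∈ [0, ∞]
(arXiv:1005.0743 Def./Thm. 'geometric invariant', arXiv:1010.2421 for slabs with inner boundary) —
topic Literature/Geometry/Lorentzian; needed to type KillingSpinorCoercivity. (2) notion
KillingSpinorObstructionField — on a `Spacetime 4` with Levi-Civita connection: Killing-spinor
candidates as complex self-dual 2-forms κ, the propagation equation □κ + Riem⋆κ = 0, the
zero-quantities H (conformal Killing–Yano defect of κ) and S (Killing defect of ξ = div κ), and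
their energy on slabs — topic Literature/Geometry/Lorentzian; needed to type ObstructionFieldDecay
and ObstructionPropagatesHomogeneously. Cite facts wanted: GP-VK propagation theorem
(arXiv:0712.3373), B–VK boundary formula for I on a DOC slice (arXiv:1010.2421 Thm.), Andersson–Blue
Morawetz (AnderssonBlue2015 Thm. 1.?) — filed as `--kind cite` items when the carriers exist.

Novelty: Searches (2026-08-15): this session `lit search "non-Kerrness invariant Killing spinor initial data
evolution stability"` and `lit search "Killing spinor initial data non-Kerrness invariant Kerr
stability" --source all` → searchd unavailable (rc 75, twice; recorded in NOTES.md); relied on the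
card's logged searches (zbMATH 'geometric invariant measuring deviation from Kerr data' →
arXiv:1005.0743; 'non-Kerrness domains of outer communication' → arXiv:1010.2421; 'Killing spinor
initial data sets' → arXiv:0712.3373; 'stability linearized gravity Kerr Andersson Bäckdahl Blue Ma'
→ arXiv:1903.03859, arXiv:2108.03148) and on the refuter novelty audit of the card (READ
arXiv:1001.4492 p. 5 'Applications and generalizations'; arXiv:1610.03540 §2.6/§5.1), plus `ledger
route ls` / digest routes.json (0 routes on this summit) and `ledger negatives` (empty).
Nearest prior art found: arXiv:1001.4492 (Bäckdahl–Valiente Kroon PRL 2010: propose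
monotonicity/evolution of the non-Kerrness invariant as a tool for nonlinear Kerr stability — the
idea of I[Σ_τ] as order parameter); arXiv:0712.3373 (GP-VK: the closed homogeneous propagation
system — our informal support item); KlainermanSzeftel2023 + GiorgiKlainermanSzeftel2022 (the
GCM/modulation endgame this route replaces); AnderssonBlue2015 (hidden-symmetry commutator Morawetz
on exact Kerr).
Delta: nobody has (a) taken ζ = (H, S) of the DYNAMICAL metric as the bootstrap unknown with the
charges pinned in advance, nor (b) reduced the typed fin  [refs: 1005.0743, 1010.2421, 0712.3373, 1903.03859, 2108.03148, 1001.4492, 1610.03540, KlainermanSzeftel2023, GiorgiKlainermanSzeftel2022, AnderssonBlue2015]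

Barriers (technique_class: kerr-stability, hidden-symmetry, gauge-free): - technique_class: kerr-stability, hidden-symmetry, gauge-free
- Literature.Barriers.FinalStateConjecture.SlowlyRotatingKerrFrontier: met head-on, not evaded:
ENDGAME quantifies over all |aᵢ| < Mᵢ; the bet is that with charges known and a gauge-invariant
unknown ζ the hidden-symmetry commutators (which exist for every |a| < M) replace the
perturbation-of-Schwarzschild structure of the |a| ≪ M proofs; frequency-space input
(ShlapentokhrothmanCosta2020) is declared for ObstructionFieldDecay at large |a|.
- Literature.Barriers.FinalStateConjecture.KerrSuperradiance: ζ's system is tensorial/spin-weighted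
and not known to decouple into Teukolsky equations; if it does not, superradiant frequencies must be
handled by hidden-symmetry-modified energies (Andersson–Blue, small |a| only) — the barrier bites at
large |a| and the route says so (why-might-fail of the rank-5 informal crux).
- Literature.Barriers.FinalStateConjecture.SbierskiTrappingObstruction: every decay statement for ζ
is integrated local energy decay WITH derivative loss at trapping, exactly the loss that commuting
with the (approximate) Carter operator recovers; no loss-free LED is claimed.
- Literature.Barriers.FinalStateConjecture.AretakisInstability: ENDGAME and CAPTURE demand strict
sub-extremality |aᵢ| < Mᵢ and inner radii r₀ᵢ > r₋; the red-shift for ζ needs positive surface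
gravity; extremal limits are left to CAPTURE's genericity (third-law cards), not claimed.
- Literature.Barriers.FinalStateConjecture.PriceLawT

History (route lifecycle, newest last):
- 2026-08-15T16:39:22Z · rev 4: restated KillingSpinorEndgame (stmt-FinalStateConjecture-9925) — repair 2/3 (rrepair g3): KillingSpinorEndgame re-typed with the same near-zone tie '∀ i, r₀ i + 1 ≤ R i' as KerrBasinCapture (refuter route review rreview-0815T (planner-rrepair-FinalStateConjecture-KerrnessP-b27e867a-g3-0)
- 2026-08-15T16:40:04Z · rev 5: restated SingleKerrEndgame (stmt-FinalStateConjecture-9928) — repair 3/3 (rrepair g3): SingleKerrEndgame (N = 1 support case) was refuted-misstated ON PAPER by refuter-rreview-0815T14-11-0 (Minkowski satisfies the hypothes (planner-rrepair-FinalStateConjecture-KerrnessP-b27e867a-g3-0)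
- 2026-08-15T22:02:16Z · rev 7: restated KillingSpinorCoercivity (stmt-FinalStateConjecture-9975) — repair (route-repair, refuted-misstated on paper by refuter-rattack-stmt-FinalStateConjecture-9975-0): KillingSpinorCoercivity TYPED as the refuter's C'' over t (planner-rrefute-FinalStateConjecture-KerrnessP-5822f53d-0)
- 2026-08-16T23:25:14Z · rev 8: restated KillingSpinorEndgame (stmt-FinalStateConjecture-11009), KerrBasinCapture (stmt-FinalStateConjecture-11070), SingleKerrEndgame (stmt-FinalStateConjecture-11032) — route-repair (statement-revised p126844, re-type T2): restated KerrBasinCapture → IsTameChristodoulouGeneric + future-oriented hand-over slab  (planner-rrepair-FinalStateConjecture-KerrnessP-9f9f9871-0)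
- 2026-08-16T23:27:36Z · rev 10: restated MaximalDevelopmentExists (stmt-FinalStateConjecture-9927) — route-repair (cont. 2): restate MaximalDevelopmentExists VERBATIM as the summit's shared MGHD-existence item stmt-FinalStateConjecture-9937 (binder style `∀ D ∈ (planner-rrepair-FinalStateConjecture-KerrnessP-9f9f9871-0)
- 2026-08-25T10:05:24Z · DORMANT — reconciler: no traction for 7.6 d (last activity item-evidence-added at 2026-08-17T19:11:08Z); parked, not closed — `ledger route dormant route-FinalStateConjec (operator:999:2803131)
- 2026-08-30T17:06:14Z · REACTIVATED (open) — reconciler: reactivated — activity statement-checked at 2026-08-30T15:54:01Z after parking at 2026-08-25T10:05:24Z (operator:999:405506)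
- 2026-09-04T18:32:23Z · DORMANT — reconciler: no traction for 5 d (last activity statement-checked at 2026-08-30T17:39:34Z); parked, not closed — `ledger route dormant route-FinalStateConjecture (operator:999:2113188)

sub-problem: FinalStateConjecture · status: dormant · opened planner-plancard-FinalStateConjecture-FinalSt-939fa555-0 2026-08-15T14:56:42Z · rev 12 · ledger route-FinalStateConjecture-KerrnessPropagates
GENERATED by the gate from the ledger (D-0016/17). Provers cite these decls: `theorem foo : Summit.FinalStateConjecture.FinalStateConjecture.Theses.KerrnessPropagates.<Decl> := …` in Summits/FinalStateConjecture/FinalStateConjecture/Theorems/<Name>.lean.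
-/

namespace Summit.FinalStateConjecture.FinalStateConjecture.Theses.KerrnessPropagates

open scoped BigOperators Topology Manifold Classical MeasureTheory ProbabilityTheory Matrix InnerProductSpace ComplexConjugate ContinuousMap
open Filter Set Function TopologicalSpace MeasureTheory

attribute [summit_statement] _root_.FinalStateConjecture

-- earlier KillingSpinorEndgame (stmt-FinalStateConjecture-11009, replaced 2026-08-16T23:25:14Z -> stmt-FinalStateConjecture-17645): retired by None — ∃ k : ℕ, ∀ (X : Type) [TopologicalSpace X] [ChartedSpace Literature.Geometry.Lorentzian.E3 X] [IsManifold (modelWithCornersSelf ℝ Literature.Geometry.Lorentzian.E3) ((⊤ : ℕ∞) : WithTop ℕ∞) X] [T2Space X] [SecondCountableTopology X] [ConnectedSpace X] (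
-- earlier KillingSpinorEndgame (stmt-FinalStateConjecture-9925, replaced 2026-08-15T16:39:22Z -> stmt-FinalStateConjecture-11009): retired by None — ∃ k : ℕ, ∀ (X : Type) [TopologicalSpace X] [ChartedSpace Literature.Geometry.Lorentzian.E3 X] [IsManifold (modelWithCornersSelf ℝ Literature.Geometry.Lorentzian.E3) ((⊤ : ℕ∞) : WithTop ℕ∞) X] [T2Space X] [SecondCountableTopology X] [ConnectedSpace X] (D
/-- item stmt-FinalStateConjecture-17645 · crux · rank 2 · open · by planner
why it might fail: Contains sub-extremal Kerr asymptotic stability for all |a|<M (open beyond |a|≪M) and an N≥2 weak-interaction theorem nobody has; far-zone smallness is unweighted sup-norm (decay at i⁰ only from o₂(r⁻¹) admissibility), maybe too rough for C² on near zones growing R(τ)→∞.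
sources: DafermosRodnianski2008, KlainermanSzeftel2023, GiorgiKlainermanSzeftel2022, DafermosHolzegelRodnianskiTaylor2021, AnderssonBlue2015, arXiv:0712.3373
[crux] ENDGAME (card killing-spinor-obstruction-as-linear-field, items D3–D5 fused into one typed
statement; RESTATED 2026-08-16 for the re-typed Statement p126844): there is a regularity k such
that for every admissible datum, every MGHD with complete 𝓘⁺ which (i) recurs — every ε, arbitrarily
late τ, one lab-time chart Φ, horizon-penetrating near discs {r₀ᵢ < rᵢ ≤ Rᵢ} with r₀ᵢ+1 ≤ Rᵢ ε-close
in Cᵏ to boosted Kerr–Schild Kerrᵢ, far zone {rⱼ ≥ Rⱼ−1} ε-flat, achronal slab image in J⁺(ιX), and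
FUTURE-ORIENTED: Φ_*∂₀ future-directed causal on the far zone (new; the slab analogue of
IsFutureOriented) — to a FIXED sub-extremal multi-Kerr configuration p, and (ii) satisfies the
INTERIOR LEMMA handed over by CAPTURE — every honest C² Kerr decomposition (O, d) of it
(sub-extremal holes, O = exteriorOf, HasExhaustiveCharts, IsFutureOriented) has RaysStayInClosure O
(new hypothesis) — admits the re-typed conclusion verbatim: ∃ O d, sub-extremal holes ∧ O = J⁺(ιX) ∩
I⁻(charted) ∧ RaysStayInClosure O ∧ HasExhaustiveCharts d (honest growing radii) ∧ IsFutureOriented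
d. The Rays conjunct is discharged by (ii) applied to the decomposition built, so the content is the
EXTERIOR construction: non-Ke -/
@[route_item "route-FinalStateConjecture-KerrnessPropagates"]
def KillingSpinorEndgame : Prop :=
  ∃ k : ℕ, ∀ (X : Type) [TopologicalSpace X] [ChartedSpace Literature.Geometry.Lorentzian.E3 X] [IsManifold (𝓡 3) (⊤ : ℕ∞) X] [T2Space X] [SecondCountableTopology X] [ConnectedSpace X] (D : Literature.Geometry.Lorentzian.InitialDataSet (𝓡 3) X), D ∈ Literature.Geometry.Lorentzian.admissibleVacuumData X → ∀ 𝒟 : Literature.Geometry.Lorentzian.VacuumCauchyDevelopment D, 𝒟.IsMaximal → Summit.FinalStateConjecture.HasCompleteNullInfinity 𝒟.toCauchyDevelopment → (∃ (N : ℕ) (M a r₀ : Fin N → ℝ) (mo : Fin N → ↥Literature.Geometry.Lorentzian.lorentzGroup × Literature.Geometry.Lorentzian.E4), (∀ i, Literature.Geometry.Lorentzian.Kerr.IsSubextremal (M i) (a i) ∧ r₀ i ∈ Ioo (Literature.Geometry.Lorentzian.Kerr.rMinus (M i) (a i)) (Literature.Geometry.Lorentzian.Kerr.rPlus (M i) (a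 i))) ∧ ∀ ε : ℝ, 0 < ε → ∀ τ₁ : ℝ, ∃ τ : ℝ, τ₁ ≤ τ ∧ ∃ (R : Fin N → ℝ) (U : Opens Literature.Geometry.Lorentzian.E4) (Φ : U → 𝒟.carrier), (∀ i, r₀ i + 1 ≤ R i) ∧ ContMDiff 𝓘(ℝ, Literature.Geometry.Lorentzian.E4) (𝓡 4) (⊤ : ℕ∞) Φ ∧ Topology.IsOpenEmbedding Φ ∧ {x : Literature.Geometry.Lorentzian.E4 | x 0 = τ ∧ (∀ j, r₀ j < Literature.Geometry.Lorentzian.Kerr.radius (a j) (Literature.Geometry.Lorentzian.poincareInv (mo j).1 (mo j).2 x))} ⊆ (U : Set Literature.Geometry.Lorentzian.E4) ∧ range Φ ⊆ 𝒟.metric.causalFuture 𝒟.timeOrientation (range 𝒟.embed) ∧ 𝒟.metric.IsAchronal 𝒟.timeOrientation (Φ '' {x : ↥U | (x : Literature.Geometry.Lorentzian.E4) 0 = τ}) ∧ (∀ i, Literature.Geometry.Lorentzian.supCkENorm {x : Literature.Geometry.Lorentzian.E4 | x 0 = τ ∧ (∀ j, r₀ j < Literature.Geometry.Lorentzian.Kerr.radius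 (a j) (Literature.Geometry.Lorentzian.poincareInv (mo j).1 (mo j).2 x)) ∧ Literature.Geometry.Lorentzian.Kerr.radius (a i) (Literature.Geometry.Lorentzian.poincareInv (mo i).1 (mo i).2 x) ≤ R i} k (𝒟.toSpacetime.deviationExtend ⟨U, Literature.Geometry.Lorentzian.boostedKerrBilin (mo i).1 (mo i).2 (M i) (a i), fun x ↦ x 0, fun x ↦ Literature.Geometry.Lorentzian.Kerr.radius (a i) (Literature.Geometry.Lorentzian.poincareInv (mo i).1 (mo i).2 x)⟩ Φ) ≤ ENNReal.ofReal ε) ∧ Literature.Geometry.Lorentzian.supCkENorm {x : Literature.Geometry.Lorentzian.E4 | x 0 = τ ∧ (∀ j, r₀ j < Literature.Geometry.Lorentzian.Kerr.radius (a j) (Literature.Geometry.Lorentzian.poincareInv (mo j).1 (mo j).2 x)) ∧ ∀ j, R j - 1 ≤ Literature.Geometry.Lorentzian.Kerr.radius (a j) (Literature.Geometry.Lorentzian.poincareInv (mo j).1 (mo j).2 x)} k (𝒟.toSpacetime.deviationExtend (Literature.Geometry.Lorentzian.Minkowski.backgroundOn U) Φ) ≤ ENNReal.ofReal ε ∧ (∀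 x : ↥U, x.1 0 = τ → (∀ j, R j - 1 ≤ Literature.Geometry.Lorentzian.Kerr.radius (a j) (Literature.Geometry.Lorentzian.poincareInv (mo j).1 (mo j).2 x.1)) → 𝒟.timeOrientation.IsFutureDirected (mfderiv 𝓘(ℝ, Literature.Geometry.Lorentzian.E4) (𝓡 4) Φ x (Literature.Geometry.Lorentzian.E4.basisVector 0)))) → (∀ (O : Set 𝒟.carrier) (d : Literature.Geometry.Lorentzian.FinalStateDecomposition 𝒟.toSpacetime O 2), (∀ i, Literature.Geometry.Lorentzian.Kerr.IsSubextremal (d.mass i) (d.spin i)) → O = Summit.FinalStateConjecture.exteriorOf 𝒟.toCauchyDevelopment d.charted → Summit.FinalStateConjecture.HasExhaustiveCharts d → Summit.FinalStateConjecture.IsFutureOriented d → Summit.FinalStateConjecture.RaysStayInClosure 𝒟.toCauchyDevelopment O) → ∃ (O : Set 𝒟.carrier) (d : Literature.Geometry.Lorentzian.FinalStateDecomposition 𝒟.toSpacetime O 2), (∀ i, Literature.Geometry.Lorentzian.Kerr.IsSubextremal (d.mass i) (d.spin i)) ∧ O = Summit.FinalStateConjecture.exteriorOf 𝒟.toCauchyDevelopment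 d.charted ∧ Summit.FinalStateConjecture.RaysStayInClosure 𝒟.toCauchyDevelopment O ∧ Summit.FinalStateConjecture.HasExhaustiveCharts d ∧ Summit.FinalStateConjecture.IsFutureOriented d

-- earlier KerrBasinCapture (stmt-FinalStateConjecture-11070, replaced 2026-08-16T23:25:14Z -> stmt-FinalStateConjecture-17646): retired by None — ∀ k : ℕ, ∀ (X : Type) [TopologicalSpace X] [ChartedSpace Literature.Geometry.Lorentzian.E3 X] [IsManifold (modelWithCornersSelf ℝ Literature.Geometry.Lorentzian.E3) ((⊤ : ℕ∞) : WithTop ℕ∞) X] [T2Space X] [SecondCountableTopology X] [ConnectedSpace X], Lite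
-- earlier KerrBasinCapture (stmt-FinalStateConjecture-9926, replaced 2026-08-15T16:38:19Z -> stmt-FinalStateConjecture-11070): retired by None — ∀ k : ℕ, ∀ (X : Type) [TopologicalSpace X] [ChartedSpace Literature.Geometry.Lorentzian.E3 X] [IsManifold (modelWithCornersSelf ℝ Literature.Geometry.Lorentzian.E3) ((⊤ : ℕ∞) : WithTop ℕ∞) X] [T2Space X] [SecondCountableTopology X] [ConnectedSpace X], Liter
/-- item stmt-FinalStateConjecture-17646 · crux · rank 3 · open · by planner
why it might fail: Weak cosmic censorship + 'generic end states are receding multi-Kerr clusters', wide open; tame curve-genericity must absorb critical-collapse thresholds; the interior lemma fails openly on bag-of-gold data (complete rays in a baby universe) if such vacuum MGHDs exist.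
sources: Christodoulou1999, DafermosLuk2017, Penrose1982, Christodoulou2008, ChristodoulouKlainerman1993, arXiv:gr-qc/0403066
[crux] CAPTURE (the large-data leg; RESTATED 2026-08-16 for the re-typed Statement p126844 — TAME
genericity, future-oriented hand-over, interior lemma): for every k and every data manifold X,
`IsTameChristodoulouGeneric (admissibleVacuumData X) Q_k 1` — through every admissible datum failing
Q_k passes an injective one-parameter admissible family, tame on ONE fixed asymptotically flat end
(DR rates, continuous mass, wDist-continuous at 0) and immersed at 0, whose other members satisfy
Q_k — where Q_k(D) says: every maximal vacuum Cauchy development of D has complete future null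
infinity (weak cosmic censorship); RECURS, for every ε > 0 and beyond every lab time, to one fixed
configuration p = (N, Mᵢ, aᵢ sub-extremal, r₀ᵢ ∈ (r₋, r₊), Λᵢ, cᵢ) in the one-chart slab sense (near
discs r₀ᵢ < rᵢ ≤ Rᵢ, r₀ᵢ+1 ≤ Rᵢ, ε-Kerr in Cᵏ; far zone rⱼ ≥ Rⱼ−1 ε-flat; achronal slab image in
J⁺(ιX)) with the slab chart FUTURE-ORIENTED (Φ_*∂₀ future-directed causal on the far zone); and
satisfies the INTERIOR LEMMA: every honest C² Kerr final-state decomposition (O, d) of that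
development — sub-extremal holes, O = J⁺(ιX) ∩ I⁻(charted), HasExhaustiveCharts, IsFutureOriented —
keeps every future-complete n -/
@[route_item "route-FinalStateConjecture-KerrnessPropagates"]
def KerrBasinCapture : Prop :=
  ∀ k : ℕ, ∀ (X : Type) [TopologicalSpace X] [ChartedSpace Literature.Geometry.Lorentzian.E3 X] [IsManifold (𝓡 3) (⊤ : ℕ∞) X] [T2Space X] [SecondCountableTopology X] [ConnectedSpace X], Literature.Geometry.Lorentzian.InitialDataSet.IsTameChristodoulouGeneric (Literature.Geometry.Lorentzian.admissibleVacuumData X) (fun D ↦ ∀ 𝒟 : Literature.Geometry.Lorentzian.VacuumCauchyDevelopment D, 𝒟.IsMaximal → Summit.FinalStateConjecture.HasCompleteNullInfinity 𝒟.toCauchyDevelopment ∧ (∃ (N : ℕ) (M a r₀ : Fin N → ℝ) (mo : Fin N → ↥Literature.Geometry.Lorentzian.lorentzGroup × Literature.Geometry.Lorentzian.E4), (∀ i, Literature.Geometry.Lorentzian.Kerr.IsSubextremal (M i) (a i) ∧ r₀ i ∈ Ioo (Literature.Geometry.Lorentzian.Kerr.rMinus (M i) (a i)) (Literature.Geometry.Lorentzian.Kerr.rPlus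 (M i) (a i))) ∧ ∀ ε : ℝ, 0 < ε → ∀ τ₁ : ℝ, ∃ τ : ℝ, τ₁ ≤ τ ∧ ∃ (R : Fin N → ℝ) (U : Opens Literature.Geometry.Lorentzian.E4) (Φ : U → 𝒟.carrier), (∀ i, r₀ i + 1 ≤ R i) ∧ ContMDiff 𝓘(ℝ, Literature.Geometry.Lorentzian.E4) (𝓡 4) (⊤ : ℕ∞) Φ ∧ Topology.IsOpenEmbedding Φ ∧ {x : Literature.Geometry.Lorentzian.E4 | x 0 = τ ∧ (∀ j, r₀ j < Literature.Geometry.Lorentzian.Kerr.radius (a j) (Literature.Geometry.Lorentzian.poincareInv (mo j).1 (mo j).2 x))} ⊆ (U : Set Literature.Geometry.Lorentzian.E4) ∧ range Φ ⊆ 𝒟.metric.causalFuture 𝒟.timeOrientation (range 𝒟.embed) ∧ 𝒟.metric.IsAchronal 𝒟.timeOrientation (Φ '' {x : ↥U | (x : Literature.Geometry.Lorentzian.E4) 0 = τ}) ∧ (∀ i, Literature.Geometry.Lorentzian.supCkENorm {x : Literature.Geometry.Lorentzian.E4 | x 0 = τ ∧ (∀ j, r₀ j < Literature.Geometry.Lorentzian.Kerr.radius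 (a j) (Literature.Geometry.Lorentzian.poincareInv (mo j).1 (mo j).2 x)) ∧ Literature.Geometry.Lorentzian.Kerr.radius (a i) (Literature.Geometry.Lorentzian.poincareInv (mo i).1 (mo i).2 x) ≤ R i} k (𝒟.toSpacetime.deviationExtend ⟨U, Literature.Geometry.Lorentzian.boostedKerrBilin (mo i).1 (mo i).2 (M i) (a i), fun x ↦ x 0, fun x ↦ Literature.Geometry.Lorentzian.Kerr.radius (a i) (Literature.Geometry.Lorentzian.poincareInv (mo i).1 (mo i).2 x)⟩ Φ) ≤ ENNReal.ofReal ε) ∧ Literature.Geometry.Lorentzian.supCkENorm {x : Literature.Geometry.Lorentzian.E4 | x 0 = τ ∧ (∀ j, r₀ j < Literature.Geometry.Lorentzian.Kerr.radius (a j) (Literature.Geometry.Lorentzian.poincareInv (mo j).1 (mo j).2 x)) ∧ ∀ j, R j - 1 ≤ Literature.Geometry.Lorentzian.Kerr.radius (a j) (Literature.Geometry.Lorentzian.poincareInv (mo j).1 (mo j).2 x)} k (𝒟.toSpacetime.deviationExtend (Literature.Geometry.Lorentzian.Minkowski.backgroundOn U) Φ) ≤ ENNReal.ofReal ε ∧ (∀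 x : ↥U, x.1 0 = τ → (∀ j, R j - 1 ≤ Literature.Geometry.Lorentzian.Kerr.radius (a j) (Literature.Geometry.Lorentzian.poincareInv (mo j).1 (mo j).2 x.1)) → 𝒟.timeOrientation.IsFutureDirected (mfderiv 𝓘(ℝ, Literature.Geometry.Lorentzian.E4) (𝓡 4) Φ x (Literature.Geometry.Lorentzian.E4.basisVector 0)))) ∧ (∀ (O : Set 𝒟.carrier) (d : Literature.Geometry.Lorentzian.FinalStateDecomposition 𝒟.toSpacetime O 2), (∀ i, Literature.Geometry.Lorentzian.Kerr.IsSubextremal (d.mass i) (d.spin i)) → O = Summit.FinalStateConjecture.exteriorOf 𝒟.toCauchyDevelopment d.charted → Summit.FinalStateConjecture.HasExhaustiveCharts d → Summit.FinalStateConjecture.IsFutureOriented d → Summit.FinalStateConjecture.RaysStayInClosure 𝒟.toCauchyDevelopment O)) 1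

-- earlier KillingSpinorCoercivity (stmt-FinalStateConjecture-9975, replaced 2026-08-15T22:02:16Z -> stmt-FinalStateConjecture-13853): retired by None — [crux] QUANTITATIVE BÄCKDAHL–VALIENTE KROON (card D5; the refuter audit's flagged crux). For a smooth vacuum initial data set (S, h, K) with one asymptotically flat end (admissible rates) and compact inner boundary a marginally outer trapped surface,
/-- item stmt-FinalStateConjecture-13853 · crux · rank 4 · open · by planner
why it might fail: Needs the linearised KSID-residual map at Kerr–Schild Kerr data to have kernel = gauge (slice ⊕ diffeo) and closed range in H²_{-1}×H¹_0 — a Killing-spinor linearisation-stability theorem not in print; I₁ is blind to principal-frame-aligned δC, so H² control rests on J + constraints (maybe only H¹).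
sources: BackdahlValientekroon2010, BackdahlValientekroon2011, GomezloboValientekroon2008, arXiv:1005.0743, arXiv:1010.2421, arXiv:0712.3373
[crux] QUANTITATIVE BÄCKDAHL–VALIENTE KROON, REPAIRED (C″ of the refuter crux-attack 2026-08-15 on
stmt-FinalStateConjecture-9975; card D5). Fix sub-extremal (M, a), 0 < M, an inner radius r₀ ∈ (r₋,
r₊) and a decay exponent δ′ > 2. There are B > 0 and C such that for every smooth solution D = (h,
k) of the vacuum constraints on the Kerr–Schild slab Kerr.slice a r₀ lying in the weighted C⁴_{δ′} ×
C³_{δ′+1}-ball of radius B about the reference datum Kerr.data M a r₀ (|∂ʲ(h − h_Kerr)| ≤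
B(1+r)^{−δ′−j}, j ≤ 4; |∂ʲ(k − k_Kerr)| ≤ B(1+r)^{−δ′−1−j}, j ≤ 3): dist_𝒦(D) ≤ C · I*(D)^{1/2}.
Here (i) dist_𝒦(D) = inf ‖D − D′‖ in H²_{−1} × H¹_0 (tree convention = Bartnik H²_{−1/2} ×
H¹_{−3/2}, B–VK's space) over the ORBIT of Kerr(M, a) hypersurface data D′ on the same domain —
first and second fundamental form (future unit normal) induced by any smooth embedding φ :
Kerr.slice a r₀ → Kerr.region a r₁ into the ingoing Kerr–Schild chart of g_{M,a} (any slice, any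
parametrisation: the slice/time-gauge normalisation whose absence the refuter's witnesses W1–W3
exploited; all of them now have dist_𝒦 = 0); (ii) I*(D) = inf of the Bäckdahl–Valiente Kroon
non-Kerrness functional J + I₁ + I₂ (KillingSpinor -/
@[route_item "route-FinalStateConjecture-KerrnessPropagates"]
def KillingSpinorCoercivity : Prop :=
  ∀ [Literature.Geometry.Lorentzian.Kerr.Facts] [Literature.Geometry.Lorentzian.Kerr.SliceFacts] (M a : ℝ) (hM : 0 < M), Literature.Geometry.Lorentzian.Kerr.IsSubextremal M a → ∀ r₀ ∈ Set.Ioo (Literature.Geometry.Lorentzian.Kerr.rMinus M a) (Literature.Geometry.Lorentzian.Kerr.rPlus M a), ∀ δ' : ℝ, 2 < δ' → ∃ B > (0 : ℝ), ∃ C : ℝ, 0 ≤ C ∧ ∀ (D : Literature.Geometry.Lorentzian.InitialDataSet (modelWithCornersSelf ℝ Literature.Geometry.Lorentzian.E3) ↥(Literature.Geometry.Lorentzian.Kerr.slice a r₀)) [D.metric.HasLeviCivita], D.IsVacuumConstraintSolution → Literature.Geometry.Lorentzian.InitialDataSet.dataWeightedCkEDist 4 δ' D (Literature.Geometry.Lorentzian.Kerr.data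 M a r₀ hM.le) ≤ ENNReal.ofReal B → (⨅ (D' : Literature.Geometry.Lorentzian.InitialDataSet (modelWithCornersSelf ℝ Literature.Geometry.Lorentzian.E3) ↥(Literature.Geometry.Lorentzian.Kerr.slice a r₀)) (_ : ∃ (r₁ : ℝ) (φ : ↥(Literature.Geometry.Lorentzian.Kerr.slice a r₀) → ↥(Literature.Geometry.Lorentzian.Kerr.region a r₁)) (ν : Literature.Geometry.Lorentzian.NormalField (modelWithCornersSelf ℝ Literature.Geometry.Lorentzian.E4) φ), Manifold.IsSmoothEmbedding (modelWithCornersSelf ℝ Literature.Geometry.Lorentzian.E3) (modelWithCornersSelf ℝ Literature.Geometry.Lorentzian.E4) ((⊤ : ℕ∞) : WithTop ℕ∞) φ ∧ (Literature.Geometry.Lorentzian.Kerr.smoothMetric M a r₁).IsFutureUnitNormal (modelWithCornersSelf ℝ Literature.Geometry.Lorentzian.E3) ((Literature.Geometry.Lorentzian.Kerr.timeOrientation M a r₁ hM.le).ofLE le_top) φ ν ∧ (∀ y, Literature.Geometry.Lorentzian.pullbackBilin (I := (modelWithCornersSelf ℝ Literature.Geometry.Lorentzian.E4)) (I' := (modelWithCornersSelf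 ℝ Literature.Geometry.Lorentzian.E3)) φ (Literature.Geometry.Lorentzian.Kerr.smoothMetric M a r₁).val y = D'.h.inner y) ∧ (∀ y, (Literature.Geometry.Lorentzian.Kerr.smoothMetric M a r₁).secondFundamentalForm (modelWithCornersSelf ℝ Literature.Geometry.Lorentzian.E3) φ ν y = D'.kBilin y)), Literature.Geometry.Lorentzian.InitialDataSet.dataWeightedSobolevEDist 2 (-1) D D') ≤ ENNReal.ofReal C * (⨅ (κ : ↥(Literature.Geometry.Lorentzian.Kerr.slice a r₀) → Fin 3 → ℂ) (_ : ContMDiff (modelWithCornersSelf ℝ Literature.Geometry.Lorentzian.E3) (modelWithCornersSelf ℝ (Fin 3 → ℂ)) ((⊤ : ℕ∞) : WithTop ℕ∞) κ ∧ ∃ (e : ℝ) (p : Fin 3 → ℝ), e ^ 2 = 1 + ∑ i, p i ^ 2 ∧ Filter.Tendsto (fun y : ↥(Literature.Geometry.Lorentzian.Kerr.slice a r₀) ↦ Literature.Geometry.Lorentzian.KillingSpinorData.lapse D κ y) (Filter.comap (fun y : ↥(Literature.Geometry.Lorentzian.Kerr.slice a r₀) ↦ ‖(y : Literature.Geometry.Lorentzian.E3)‖)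 Filter.atTop) (nhds ((Real.sqrt 2 * e : ℝ) : ℂ)) ∧ ∀ i : Fin 3, Filter.Tendsto (fun y : ↥(Literature.Geometry.Lorentzian.Kerr.slice a r₀) ↦ Literature.Geometry.Lorentzian.KillingSpinorData.shift D κ y i) (Filter.comap (fun y : ↥(Literature.Geometry.Lorentzian.Kerr.slice a r₀) ↦ ‖(y : Literature.Geometry.Lorentzian.E3)‖) Filter.atTop) (nhds ((Real.sqrt 2 * p i : ℝ) : ℂ))), Literature.Geometry.Lorentzian.KillingSpinorData.nonKerrness D κ) ^ (1 / 2 : ℝ)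

-- item stmt-FinalStateConjecture-9985 · crux · rank 5 · open · by planner — informal only, no Lean statement yet:
--   [crux] LINEAR DECAY OF THE KILLING-SPINOR OBSTRUCTION ON EXACT SUB-EXTREMAL KERR (card D3 with the
--   mode census D2 folded in). On Kerr (M, a), all |a| < M, on the horizon-penetrating region
--   Kerr.region a r₀: for every solution κ of the propagation equation □κ_AB + Ψ_ABCD κ^CD = 0 with
--   finite weighted initial energy on {t* = 0}, the zero-quantities ζ = (H = ∇_{A'(A}κ_{BC)}, S_ab =
--   ∇_(a ξ_b), ξ_AA' = ∇^B_A' κ_AB) — which solve the closed García-Parrado–Valiente Kroon system —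
--   satisfy integrated local energy decay (with the trapping derivative loss) and pointwise
--   inverse-polynomial decay on {t* =

-- earlier MaximalDevelopmentExists (stmt-FinalStateConjecture-9927, replaced 2026-08-16T23:27:36Z -> stmt-FinalStateConjecture-9937): retired by None — ∀ (X : Type) [TopologicalSpace X] [ChartedSpace Literature.Geometry.Lorentzian.E3 X] [IsManifold (modelWithCornersSelf ℝ Literature.Geometry.Lorentzian.E3) ((⊤ : ℕ∞) : WithTop ℕ∞) X] [T2Space X] [SecondCountableTopology X] [ConnectedSpace X] (D : Lit
/-- item stmt-FinalStateConjecture-9937 · crux · rank 9 · open · by planner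
why it might fail: Known in print (CBG 1969 Thm 3 = unproved tree fact choquetBruhat_geroch_exists_mghd_cauchy, XL) but typing-exposed: IsMaximal makes EVERY typed VacuumCauchyDevelopment of D embed ι-compatibly into one; a rogue typed development falsifies it (1st render over VacuumDevelopment was refuted: isEmpty).
sources: ChoquetBruhatGeroch1969CMP, Sbierski2016AHP, Ringstrom2009, Literature.Geometry.Lorentzian.choquetBruhat_geroch_exists_mghd_cauchy, Literature.Geometry.Lorentzian.VacuumDevelopment.isEmpty
[support] every admissible datum has a maximal globally hyperbolic vacuum development, stated over
the repaired structure `VacuumCauchyDevelopment` (the corrected form of the deprecated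
`choquetBruhat_geroch_exists_mghd`, recorded in `CauchyProblemExistenceDefect`);
Choquet-Bruhat–Geroch 1969 Thm. 3, Sbierski 2016 Thm. 2.6. Known theorem; large formalisation;
shared by every route of this summit. [difficulty: XL] -/
@[route_item "route-FinalStateConjecture-KerrnessPropagates"]
def MaximalDevelopmentExists : Prop :=
  ∀ (X : Type) [TopologicalSpace X] [ChartedSpace Literature.Geometry.Lorentzian.E3 X] [IsManifold (𝓡 3) ((⊤ : ℕ∞) : WithTop ℕ∞) X] [T2Space X] [SecondCountableTopology X] [ConnectedSpace X], ∀ D ∈ Literature.Geometry.Lorentzian.admissibleVacuumData X, ∃ 𝒟 : Literature.Geometry.Lorentzian.VacuumCauchyDevelopment D, 𝒟.IsMaximal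

-- earlier SingleKerrEndgame (stmt-FinalStateConjecture-11032, replaced 2026-08-16T23:25:14Z -> stmt-FinalStateConjecture-17647): retired by None — ∃ k : ℕ, ∀ (X : Type) [TopologicalSpace X] [ChartedSpace Literature.Geometry.Lorentzian.E3 X] [IsManifold (modelWithCornersSelf ℝ Literature.Geometry.Lorentzian.E3) ((⊤ : ℕ∞) : WithTop ℕ∞) X] [T2Space X] [SecondCountableTopology X] [ConnectedSpace X] (D :
-- earlier SingleKerrEndgame (stmt-FinalStateConjecture-9928, replaced 2026-08-15T16:40:04Z -> stmt-FinalStateConjecture-11032): retired by None — ∃ k : ℕ, ∀ (X : Type) [TopologicalSpace X] [ChartedSpace Literature.Geometry.Lorentzian.E3 X] [IsManifold (modelWithCornersSelf ℝ Literature.Geometry.Lorentzian.E3) ((⊤ : ℕ∞) : WithTop ℕ∞) X] [T2Space X] [SecondCountableTopology X] [ConnectedSpace X] (D : 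
/-- item stmt-FinalStateConjecture-17647 · support · rank 9 · open · by planner
sources: DafermosRodnianski2008, KlainermanSzeftel2023, AnderssonBlue2015, arXiv:0712.3373, arXiv:1005.0743
[support] the N = 1 special case of KillingSpinorEndgame with scalar parameters (M, a, r₀, Λ, c),
RESTATED 2026-08-16 in step with the crux: future-oriented recurrence to one fixed sub-extremal Kerr
(Φ_*∂₀ future-directed on the far zone {r ≥ R−1}) plus the interior lemma (every honest C² Kerr
decomposition of the MGHD has RaysStayInClosure) ⇒ an exhaustive (honest growing radii),
future-oriented, ray-closed one-hole C² decomposition (d.N = 1 ∧ sub-extremal ∧ O = exteriorOf ∧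
RaysStayInClosure ∧ HasExhaustiveCharts ∧ IsFutureOriented). This is where the card's engine applies
verbatim (nonlinear Andersson–Blue with known charges); strictly weaker than Dafermos–Rodnianski
Conj. 5.1 in the recurrence hypothesis, stronger in the exhaustive-charts conclusion. The pure-logic
comparison lemmas of Theorems/KerrnessPropagatesSingleKerrEndgame.lean (crux ⇒ this item minus d.N =
1; antitonicity in k) need the two new clauses threaded (mechanical). [difficulty: open-problem]
[deps: KillingSpinorEndgame] -/
@[route_item "route-FinalStateConjecture-KerrnessPropagates"]
def SingleKerrEndgame : Prop :=
  ∃ k : ℕ, ∀ (X : Type) [TopologicalSpace X] [ChartedSpace Literature.Geometry.Lorentzian.E3 X] [IsManifold (𝓡 3) (⊤ : ℕ∞) X] [T2Space X] [SecondCountableTopology X] [ConnectedSpace X] (D : Literature.Geometry.Lorentzian.InitialDataSet (𝓡 3) X), D ∈ Literature.Geometry.Lorentzian.admissibleVacuumData X → ∀ 𝒟 : Literature.Geometry.Lorentzian.VacuumCauchyDevelopment D, 𝒟.IsMaximal → Summit.FinalStateConjecture.HasCompleteNullInfinity 𝒟.toCauchyDevelopment → (∃ (M a r₀ : ℝ)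 (mo : ↥Literature.Geometry.Lorentzian.lorentzGroup × Literature.Geometry.Lorentzian.E4), (Literature.Geometry.Lorentzian.Kerr.IsSubextremal M a ∧ r₀ ∈ Ioo (Literature.Geometry.Lorentzian.Kerr.rMinus M a) (Literature.Geometry.Lorentzian.Kerr.rPlus M a)) ∧ ∀ ε : ℝ, 0 < ε → ∀ τ₁ : ℝ, ∃ τ : ℝ, τ₁ ≤ τ ∧ ∃ (R : ℝ) (U : Opens Literature.Geometry.Lorentzian.E4) (Φ : U → 𝒟.carrier), r₀ + 1 ≤ R ∧ ContMDiff 𝓘(ℝ, Literature.Geometry.Lorentzian.E4) (𝓡 4) (⊤ : ℕ∞) Φ ∧ Topology.IsOpenEmbedding Φ ∧ {x : Literature.Geometry.Lorentzian.E4 | x 0 = τ ∧ r₀ < Literature.Geometry.Lorentzian.Kerr.radius a (Literature.Geometry.Lorentzian.poincareInv mo.1 mo.2 x)} ⊆ (U : Set Literature.Geometry.Lorentzian.E4) ∧ range Φ ⊆ 𝒟.metric.causalFuture 𝒟.timeOrientation (range 𝒟.embed) ∧ 𝒟.metric.IsAchronal 𝒟.timeOrientation (Φ '' {x : ↥U |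 (x : Literature.Geometry.Lorentzian.E4) 0 = τ}) ∧ Literature.Geometry.Lorentzian.supCkENorm {x : Literature.Geometry.Lorentzian.E4 | x 0 = τ ∧ r₀ < Literature.Geometry.Lorentzian.Kerr.radius a (Literature.Geometry.Lorentzian.poincareInv mo.1 mo.2 x) ∧ Literature.Geometry.Lorentzian.Kerr.radius a (Literature.Geometry.Lorentzian.poincareInv mo.1 mo.2 x) ≤ R} k (𝒟.toSpacetime.deviationExtend ⟨U, Literature.Geometry.Lorentzian.boostedKerrBilin mo.1 mo.2 M a, fun x ↦ x 0, fun x ↦ Literature.Geometry.Lorentzian.Kerr.radius a (Literature.Geometry.Lorentzian.poincareInv mo.1 mo.2 x)⟩ Φ) ≤ ENNReal.ofReal ε ∧ Literature.Geometry.Lorentzian.supCkENorm {x : Literature.Geometry.Lorentzian.E4 | x 0 = τ ∧ R - 1 ≤ Literature.Geometry.Lorentzian.Kerr.radius a (Literature.Geometry.Lorentzian.poincareInv mo.1 mo.2 x)} k (𝒟.toSpacetime.deviationExtend (Literature.Geometry.Lorentzian.Minkowski.backgroundOn U) Φ) ≤ ENNReal.ofReal ε ∧ (∀ x : ↥U,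 x.1 0 = τ → R - 1 ≤ Literature.Geometry.Lorentzian.Kerr.radius a (Literature.Geometry.Lorentzian.poincareInv mo.1 mo.2 x.1) → 𝒟.timeOrientation.IsFutureDirected (mfderiv 𝓘(ℝ, Literature.Geometry.Lorentzian.E4) (𝓡 4) Φ x (Literature.Geometry.Lorentzian.E4.basisVector 0)))) → (∀ (O : Set 𝒟.carrier) (d : Literature.Geometry.Lorentzian.FinalStateDecomposition 𝒟.toSpacetime O 2), (∀ i, Literature.Geometry.Lorentzian.Kerr.IsSubextremal (d.mass i) (d.spin i)) → O = Summit.FinalStateConjecture.exteriorOf 𝒟.toCauchyDevelopment d.charted → Summit.FinalStateConjecture.HasExhaustiveCharts d → Summit.FinalStateConjecture.IsFutureOriented d → Summit.FinalStateConjecture.RaysStayInClosure 𝒟.toCauchyDevelopment O) → ∃ (O : Set 𝒟.carrier) (d : Literature.Geometry.Lorentzian.FinalStateDecomposition 𝒟.toSpacetime O 2), d.N = 1 ∧ (∀ i, Literature.Geometry.Lorentzian.Kerr.IsSubextremal (d.mass i) (d.spin i)) ∧ O = Summit.FinalStateConjecture.exteriorOf 𝒟.toCauchyDevelopment d.charted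 ∧ Summit.FinalStateConjecture.RaysStayInClosure 𝒟.toCauchyDevelopment O ∧ Summit.FinalStateConjecture.HasExhaustiveCharts d ∧ Summit.FinalStateConjecture.IsFutureOriented d

-- item stmt-FinalStateConjecture-9986 · support · rank 9 · open · by planner — informal only, no Lean statement yet:
--   [support, known: García-Parrado–Valiente Kroon, J. Geom. Phys. 58 (2008) 1186 = arXiv:0712.3373,
--   propagation theorem] In a Ricci-flat 4-dimensional spacetime, if κ_AB solves □κ_AB + Ψ_ABCD κ^CD = 0
--   then H_{A'ABC} := ∇_{A'(A}κ_{BC)} and S_ab := ∇_(a ξ_b) with ξ_AA' := ∇^B_A' κ_AB satisfy a closed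
--   system of linear homogeneous wave equations □H = L₁(Ψ; H, S, ∇S), □S = L₂(Ψ, ∇Ψ; H, ∇H, S) with
--   coefficients polynomial in the Weyl spinor and its derivative; in particular (H, S) and their first
--   derivatives vanishing on a Cauchy hypersurface imply κ is a Killing spinor on the development. Filed
--   as sup

/-- item stmt-FinalStateConjecture-9929 · assembly · rank 1 · closed · proved by Summit.FinalStateConjecture.FinalStateConjecture.Theorems.KerrnessPropagates.assembly_proof @ 32153175d16e (prover) · by planner
sources: Christodoulou1999, DafermosLuk2017
[assembly] MaximalDevelopmentExists → KerrBasinCapture → KillingSpinorEndgame → FinalStateConjecture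
(monotonicity of Christodoulou genericity; proved). -/
@[route_item "route-FinalStateConjecture-KerrnessPropagates"]
def Assembly : Prop :=
  MaximalDevelopmentExists → KerrBasinCapture → KillingSpinorEndgame → FinalStateConjecture

-- `Assembly` holds: proved by `Summit.FinalStateConjecture.FinalStateConjecture.Theorems.KerrnessPropagates.assembly_proof` @ 32153175d16e (its module imports this route file, so no `_holds` link can be stated here).

/-! D-0027 §2.1 — DECIDING THEOREM (planner-authored via `route open/edit --closes-file`; by planner-rbadge-FinalStateConjecture-KerrnessPr-b27e867a-0 2026-08-16T23:47:20Z):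
its hypotheses are this route's items and its conclusion the sub-problem Statement (glue_lint), and it elaborates with this file. -/

@[closes "route-FinalStateConjecture-KerrnessPropagates"] theorem closes : MaximalDevelopmentExists → KerrBasinCapture → KillingSpinorEndgame →
    FinalStateConjecture := by
  intro hM hC hE
  obtain ⟨k, hk⟩ := hE
  intro X _ _ _ _ _ _
  -- tame Christodoulou genericity (codimension 1 in the admissible class) is monotone in the
  -- property: the witness pair (e, F) through an exceptional datum is reused verbatim
  have mono : ∀ {P Q : Literature.Geometry.Lorentzian.InitialDataSet (𝓡 3) X → Prop},
      (∀ D ∈ Literature.Geometry.Lorentzian.admissibleVacuumData X, Q D → P D) →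
      Literature.Geometry.Lorentzian.InitialDataSet.IsTameChristodoulouGeneric
        (Literature.Geometry.Lorentzian.admissibleVacuumData X) Q 1 →
      Literature.Geometry.Lorentzian.InitialDataSet.IsTameChristodoulouGeneric
        (Literature.Geometry.Lorentzian.admissibleVacuumData X) P 1 := by
    intro P Q hPQ hQ D hD
    obtain ⟨e, F, hF, himm, h0, hinj, hadm, hgood⟩ := hQ D ⟨hD.1, fun h ↦ hD.2 (hPQ D hD.1 h)⟩
    exact ⟨e, F, hF, himm, h0, hinj, hadm,
      fun c hc hmem ↦ hgood c hc ⟨hmem.1, fun h ↦ hmem.2 (hPQ _ hmem.1 h)⟩⟩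
  -- Q_k (CAPTURE's generic property at the regularity k fixed by ENDGAME) implies the
  -- Statement's property P for every admissible datum: MGHD existence from
  -- MaximalDevelopmentExists, complete 𝓘⁺ from Q_k, the decomposition from KillingSpinorEndgame
  refine mono ?_ (hC k X)
  intro D hD hQ
  refine ⟨hM X D hD, fun 𝒟 h𝒟 ↦ ⟨(hQ 𝒟 h𝒟).1, ?_⟩⟩
  exact hk X D hD 𝒟 h𝒟 (hQ 𝒟 h𝒟).1 (hQ 𝒟 h𝒟).2.1 (hQ 𝒟 h𝒟).2.2

end Summit.FinalStateConjecture.FinalStateConjecture.Theses.KerrnessPropagates
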